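import Summits.BirchSwinnertonDyer.BirchSwinnertonDyer.Theses.UniversalToricDescent
import Summits.BirchSwinnertonDyer.BirchSwinnertonDyer.Theorems.UniversalToricDescentTwinSplitIMCAtThreeSupsetGoodSS
import HarnessLib

/-!
# SKELETON v2 = SPLIT KIT (line `threeframes`, FACT-SHAPED stubs) for child crux `TwinSplitIMCAtThreeGoodSS`
# (stmt-BirchSwinnertonDyer-20695, bucket C = 603/2 023 twin classes) — lead prover bsd-wall-utd-p2 g4, 2026-08-27

NOT the registered skeleton (that stays `Lines/threeframes.lean`, sha16 cd65a53edf482fd3, stubs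
`stub_howardFrameSS / stub_wanFrameSS / stub_muFrameSS`). This file RESHAPES the same composition so that every stub
is LITERALLY the missing input, which is what a planner's gen-2 split of 20695 would file:
* `stub_howardClaimSS` : the OPEN preprint claim `CastellaCiperianiSkinnerSprung2018.thm57_lemma55_…_OPEN` (p545192)
  — by-name binder, NOT refereed print (Castella–Wan Math. Ann. 389 (2024) Thm 5.12 is `p > 3`);
* `stub_muFactSS` : the refereed named fact `BurungaleCastellaSkinner2025.prop422_exists_isBDPLFunction_mu_eq_zero`
  (Hsieh 2014 Thm B as quoted by BCS 2025 Prop 4.2.2) — closes only by formalisation (pattern of 20692);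
* `stub_wanFrameSS` : VERBATIM the registered research stub (rational Wan direction `3^k·Ch_Λ(X_{∅,0})·R₀⟦T⟧ ⊆ (L′)`
  at a good-supersingular 3 under the CLASSICAL Heegner hypothesis `N⁻ = 1`; no print at p = 3 — TWIN-PRINT-AT3-v1 §1
  rows 3–4; BCK21 (Algebra Number Theory 15) p.4: Wan's RS divisibility "excluded the case N⁻ = 1"; their bipartite
  primitivity road (Thm 1.1) has an EMPTY admissible set at p = 3 (barrier NoAdmissiblePrimesAtThree); their rank-one
  road (Thm 1.3: Howard + exact index formula) is utd-p2 g2's landed value route p550002, instance-level only).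
`TwinSplitIMCAtThreeGoodSS_of` concludes the crux BY NAME (one `exact` over the landed
`twinSplit_instance_of_goodSS_of_ccss_of_wanFrame`, p546254 file); `twinSplitIMCAtThreeGoodSS_of_split` is the
sorry-free GLUE a planner's split {HowardClaimSS (by-name, HOLD), MuFactSS (by-name), WanDivisibilitySS (research crux,
signature = the ∀-statement `hWan` below)} ⟹ 20695 would need ("PROVABLE NOW — one exact").
-/

noncomputable section

open scoped Classical

set_option linter.dupNamespace false
set_option autoImplicit false

namespace Summit.BirchSwinnertonDyer.BirchSwinnertonDyer.Cruxes.TwinSplitIMCAtThreeGoodSS.ThreeFramesSplit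

open PowerSeries WeierstrassCurve NumberField IsDedekindDomain Field
  Literature.NumberTheory.EllipticCurves
  Literature.NumberTheory.EllipticCurves.ModularForms
  Literature.NumberTheory.EllipticCurves.Rank1Residual
  Summit.BirchSwinnertonDyer.Rank1Residual.X11b
  Summit.BirchSwinnertonDyer.Rank1Residual.X11b.Halves
  Summit.BirchSwinnertonDyer.BirchSwinnertonDyer.Theorems.SchneiderFree
  Summit.BirchSwinnertonDyer.BirchSwinnertonDyer.Theorems.UniversalToricDescentTwinSplit

/-- STUB (by-name binder): the OPEN CÇSS18 claim — Howard-direction divisibility + torsion at a good non-ordinary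
odd prime split in `K`, `N⁻ = 1` allowed (p545192). Unrefereed; closes only if the preprint is refereed AND formalised. -/
theorem stub_howardClaimSS :
    CastellaCiperianiSkinnerSprung2018.thm57_lemma55_exists_isBDPLFunction_isTorsion_mem_charIdeal_OPEN := by
  sorry

/-- STUB (by-name binder): BCS 2025 Prop. 4.2.2 (= Hsieh 2014 Thm. B): a BDP frame with `μ = 0` at a good prime.
Refereed; closes only by formalisation. -/
theorem stub_muFactSS :
    BurungaleCastellaSkinner2025.prop422_exists_isBDPLFunction_mu_eq_zero := by
  sorry

/-- STUB (research; VERBATIM the registered `ThreeFrames.stub_wanFrameSS`): the rational Wan frame at a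
good-supersingular twin under the classical Heegner hypothesis. -/
theorem stub_wanFrameSS :
    ∀ (W' : WeierstrassCurve ℚ) [W'.IsElliptic] [W'.IsGloballyMinimal] (N' : ℕ) [NeZero N']
      (K : Type) [Field K] [NumberField K] (Dt' : ModularParametrizationData W' N'),
      GoodSS W' 3 → W'.HasSurjectiveModNGaloisRep 3 → W'.conductorNorm ℤ = N' → IsImaginaryQuadratic K →
      SatisfiesHeegnerHypothesis N' K → Odd (NumberField.discr K) →
      ∀ (κ : ZpExtension K 3), κ.IsAnticyclotomic → ∀ (γ : absoluteGaloisGroup K) [Fact (κ.IsTopGenerator γ)]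
        (𝔭 : HeightOneSpectrum (𝓞 K)), ((3 : ℕ) : 𝓞 K) ∈ 𝔭.asIdeal →
        𝔭.asIdeal.ramificationIdx (𝓞 ℚ) = 1 → 𝔭.asIdeal.inertiaDeg (𝓞 ℚ) = 1 →
        ∀ (𝔭' : HeightOneSpectrum (𝓞 K)), ((3 : ℕ) : 𝓞 K) ∈ 𝔭'.asIdeal → 𝔭' ≠ 𝔭 →
        ∀ (ι' : PadicAlgCl 3 ≃+* ℂ), BranchInducesPrime 3 ι' 𝔭 →
        ∃ (ΩK : ℂ) (Ωp : ℂ_[3]) (L : UnrSeries 3), ΩK ≠ 0 ∧ Ωp ≠ 0 ∧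
          IsBDPLFunction ι' 𝔭 κ γ Dt'.f ΩK Ωp L ∧
          ∃ k : ℕ, ∀ G ∈ (AcSelmer.XAc.charIdeal (W'.baseChange K) 3 κ 𝔭' ∅ γ).map
            (PowerSeries.map (toUnr 3)), PowerSeries.C (((3 : ℕ) : unrIntegers 3) ^ k) * G ∈ Ideal.span {L} := by
  sorry

/-- COMPOSITION: the three fact-shaped stubs give the child crux BY NAME
(`twinSplit_instance_of_goodSS_of_ccss_of_wanFrame`, landed with p546254's file). -/
theorem TwinSplitIMCAtThreeGoodSS_of :
    Summit.BirchSwinnertonDyer.BirchSwinnertonDyer.Theses.UniversalToricDescent.TwinSplitIMCAtThreeGoodSS := by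
  intro W' _ _ N' _ K _ _ Dt' hss hsurj hN' hK hH hodd κ hκ γ _ 𝔭 h𝔭 he hf 𝔭' h𝔭' hne ι' hι'
  exact twinSplit_instance_of_goodSS_of_ccss_of_wanFrame stub_howardClaimSS stub_muFactSS W' N' K Dt' hss hsurj
    hK hH hodd κ hκ γ 𝔭 h𝔭 he hf 𝔭' h𝔭' hne ι' hι'
    (stub_wanFrameSS W' N' K Dt' hss hsurj hN' hK hH hodd κ hκ γ 𝔭 h𝔭 he hf 𝔭' h𝔭' hne ι' hι')

/-- GLUE (sorry-free): the planner's prospective gen-2 split of 20695 — by-name children for the CÇSS18 claim and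
BCS25 Prop 4.2.2, and ONE research child whose signature is the ∀-statement `hWan` (= `stub_wanFrameSS`) — implies
the child crux BY NAME. -/
theorem twinSplitIMCAtThreeGoodSS_of_split
    (hC : CastellaCiperianiSkinnerSprung2018.thm57_lemma55_exists_isBDPLFunction_isTorsion_mem_charIdeal_OPEN)
    (h422 : BurungaleCastellaSkinner2025.prop422_exists_isBDPLFunction_mu_eq_zero)
    (hWan :
    ∀ (W' : WeierstrassCurve ℚ) [W'.IsElliptic] [W'.IsGloballyMinimal] (N' : ℕ) [NeZero N']
      (K : Type) [Field K] [NumberField K] (Dt' : ModularParametrizationData W' N'),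
      GoodSS W' 3 → W'.HasSurjectiveModNGaloisRep 3 → W'.conductorNorm ℤ = N' → IsImaginaryQuadratic K →
      SatisfiesHeegnerHypothesis N' K → Odd (NumberField.discr K) →
      ∀ (κ : ZpExtension K 3), κ.IsAnticyclotomic → ∀ (γ : absoluteGaloisGroup K) [Fact (κ.IsTopGenerator γ)]
        (𝔭 : HeightOneSpectrum (𝓞 K)), ((3 : ℕ) : 𝓞 K) ∈ 𝔭.asIdeal →
        𝔭.asIdeal.ramificationIdx (𝓞 ℚ) = 1 → 𝔭.asIdeal.inertiaDeg (𝓞 ℚ) = 1 →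
        ∀ (𝔭' : HeightOneSpectrum (𝓞 K)), ((3 : ℕ) : 𝓞 K) ∈ 𝔭'.asIdeal → 𝔭' ≠ 𝔭 →
        ∀ (ι' : PadicAlgCl 3 ≃+* ℂ), BranchInducesPrime 3 ι' 𝔭 →
        ∃ (ΩK : ℂ) (Ωp : ℂ_[3]) (L : UnrSeries 3), ΩK ≠ 0 ∧ Ωp ≠ 0 ∧
          IsBDPLFunction ι' 𝔭 κ γ Dt'.f ΩK Ωp L ∧
          ∃ k : ℕ, ∀ G ∈ (AcSelmer.XAc.charIdeal (W'.baseChange K) 3 κ 𝔭' ∅ γ).map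
            (PowerSeries.map (toUnr 3)), PowerSeries.C (((3 : ℕ) : unrIntegers 3) ^ k) * G ∈ Ideal.span {L}) :
    Summit.BirchSwinnertonDyer.BirchSwinnertonDyer.Theses.UniversalToricDescent.TwinSplitIMCAtThreeGoodSS := by
  intro W' _ _ N' _ K _ _ Dt' hss hsurj hN' hK hH hodd κ hκ γ _ 𝔭 h𝔭 he hf 𝔭' h𝔭' hne ι' hι'
  exact twinSplit_instance_of_goodSS_of_ccss_of_wanFrame hC h422 W' N' K Dt' hss hsurj
    hK hH hodd κ hκ γ 𝔭 h𝔭 he hf 𝔭' h𝔭' hne ι' hι'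
    (hWan W' N' K Dt' hss hsurj hN' hK hH hodd κ hκ γ 𝔭 h𝔭 he hf 𝔭' h𝔭' hne ι' hι')

end Summit.BirchSwinnertonDyer.BirchSwinnertonDyer.Cruxes.TwinSplitIMCAtThreeGoodSS.ThreeFramesSplit

end
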